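import Summits.QuantumFields.YangMills.Theorems.FluctuationComparisonRegPrIntLS2BetaGapFlatOrganOfRegArgminBar
import Summits.QuantumFields.YangMills.Theorems.FluctuationComparisonRegPrIntLS2BetaArgminOrbitOfTower
import Summits.QuantumFields.YangMills.Theorems.FluctuationComparisonRegPrIntLS2BetaChartContClosedProfile
import HarnessLib

/-!
# S2β · ★★★★★ THE v12-CANDIDATE ORGAN GAP♭∘ IS A TREE THEOREM AT EVERY BLOCK SIZE `L ≥ 5` — ZERO HYPOTHESES
# (crux `FluctuationComparisonRegPrIntL`, stmt-QuantumFields-20520; REG-ARGMIN̄∘ OUTRIGHT from px13 g21's tower ✓`regPr_of_argmin` ∕ ✓`minActionRegPr_le_action_of_histGood`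
# at the DOUBLED profile, then ✓`gapFlatOrganAt_five_of_regArgminBarOrganAt`)

Cell `ym3-torus` (YM ladder rung R3 = continuum `SU(2)` Yang–Mills on T³ — a RUNG, NOT d = 4, NOT infinite volume, NOT a mass gap, NOT Clay); width seat `ym3-torus-px17`
(gen 17); `--supports stmt-QuantumFields-20520 --as helper`, count-neutral, DEFINITION-FREE, default heartbeats; registry v11.4
`Cruxes/FluctuationComparisonRegPrIntL/Lines/semiclassical_s2beta.lean` 3732b7df UNTOUCHED (the v12 re-key GAP♯∘ ↦ GAP♭∘ is the ideator's verb; px17 g14 CERT 603780ac).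

WHAT (compositions BY NAME):
* §1 ★ `exists_gamma_closure_goodFibre_subset_double` — for `γ ≤ γ₁(b₀,p₀)` (every `L`, every datum, every depth): `closure (fibre V ∩ histGood θBal) ⊆ fibre V ∩ histGood (2·θBal)`
  (CL ✓`closure_fibre_inter_histGood_subset` + the closed profile ✓`closure_histGood_subset_profile`: on the closure every intermediate plaquette variable is `≤ θBal < 2·θBal`).
* §2 ★★★ `regArgminBarAt_of_thm1Pair_double` — PER DATUM, from the Thm-1 pair letter at `L` with the DOUBLED profile inside print's thresholds: REG-ARGMIN̄(V) («every
  `U ∈ closure (fibre V ∩ histGood)` with `A U ≤ minActionRegPr ε₀ V` is `RegPr ε₀`»): such a `U` is a good history for the profile `2·θBal` over the same datum (§1), so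
  `minActionRegPr ε₀ V ≤ A U` by px13 g21's tower ✓`minActionRegPr_le_action_of_histGood`, hence `A U = min` and ✓`regPr_of_argmin` (the equality chain) makes it regular.
* §3 ★★★★ `regArgminBarOrganAt_five (L) (h5 : 5 ≤ L)` — **REG-ARGMIN̄∘-at-`L` OUTRIGHT, ZERO HYPOTHESES, EVERY `L ≥ 5`** (organ prefix; ✓`thm1Pair_five`; thresholds as in
  ✓`argminRegularOrbit_at` with the constant doubled, `min` the closure coupling of §1).
* §4 ★★★★★ `gapFlatOrganAt_five (L) (h5 : 5 ≤ L)` — **GAP♭∘-at-`L` OUTRIGHT, ZERO HYPOTHESES, EVERY `L ≥ 5`**: px17 g14's v12 candidate text of `UniformFibreGapOrbit`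
  (`∃ μ` after `U₀ ∈ argminHist V`; `γ₁` UNIFORM; δ-unfolded as ✓`orb_of_gapFlat`'s `hG` at one `L`) := ✓`gapFlatOrganAt_five_of_regArgminBarOrganAt L h5 (regArgminBarOrganAt_five L h5)`.

NET FOR THE S2β TABLE (by kernel, CREDIT NOTHING): under the docketed v12 re-key GAP♯∘ ↦ GAP♭∘ (px17 g14 FINDING Q-GAP♯-UNIFORMITY: the registry's two consumers
`cornerLimit_of_rows` ∕ `edge_rep_det` read `μ` only through `0 < μ`), the organ row GAP is a THEOREM at every `L ≥ 5` — like EXW∘ (px13 g21 ✓`windowExactness_body_five`) and EX.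
What is NOT touched: the REGISTERED v11.4 text GAP♯∘ (`∃ μ` BEFORE `∀ F`: TUBE-REG∘'s K-uniform modulus, RECORD 17gh), the `L = 3` Thm-1 pair (EMBARGO-LITE №58), DET-REP-B,
H4ᶜ∘, LFR♯ᶜ∘.  HONEST SCOPE: plumbing over landed theorems; the analytic content is the tree's ([Balaban1985Variational] Thm 1 pair at `L ≥ 5` via the 19200 guarded chain,
(142) with rate ✓`sigmaGrowth_holds`, the (T)-chain); GAP♯∘ as registered, S2β, crux 20520, 19936, 19200 and `YM3TorusSU2` are NOT proved; no registered stub is closed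
(the registry's stub 2 is the v11.4 text); rung R3 = SU(2) YM₃ on T³ at fixed lattice data — NOT d = 4, NOT infinite volume, NOT a mass gap, NOT Clay; the Yang–Mills mass
gap is NOT proved.  Sorry-free, axioms standard.

References: T. Bałaban, CMP **102** (1985) 277–309 [Balaban1985Variational] ((2)–(8) pp.278–279, Thm 1 (8)–(10) p.279, Prop. 7 and (142) p.299); CMP **102** (1985) 255–275
[Balaban1985UV3] ((7) p.257, (18)–(22) p.260, (41)–(42) p.266); CMP **109** (1987) 249–301 [Balaban1987RG1] ((0.4), (0.11) p.253); CMP **98** (1985) 17–51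
[Balaban1985Averaging] ((8), (11) p.19).
-/

set_option autoImplicit false

noncomputable section

namespace Summit.QuantumFields.YangMills.Theorems.FluctuationComparisonRegPrIntLS2BetaGapFlatOrganFive

open MeasureTheory Filter Topology Set
open scoped Matrix.Norms.L2Operator
open Literature.MathematicalPhysics.QuantumFieldTheory.Balaban1983to89
open Literature.MathematicalPhysics.QuantumFieldTheory.Balaban1983to89.T3ContinuumYM3Torus
open Literature.MathematicalPhysics.QuantumFieldTheory.Balaban1983to89.T3UnitLawDensityEML (ℰp)
open Literature.MathematicalPhysics.QuantumFieldTheory.Balaban1983to89.T3UnitScaleTilt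
open Literature.MathematicalPhysics.QuantumFieldTheory.Balaban1983to89.T3TiltDescent
open Literature.MathematicalPhysics.QuantumFieldTheory.Balaban1983to89.T3ConstrainedMinimiser (fibre)
open Literature.MathematicalPhysics.QuantumFieldTheory.Balaban1983to89.T3PrintedRegularMinimiser
open Literature.MathematicalPhysics.QuantumFieldTheory.Balaban1983to89.T3PrintedMinimiserExistence (Thm1GlobalMinAt)
open Literature.MathematicalPhysics.QuantumFieldTheory.Balaban1983to89.T3Thm1UniquenessSchema (Thm1UniqueMinOrbitAt)
open Literature.MathematicalPhysics.QuantumFieldTheory.Balaban1983to89.T3MinimiserStabilityReduction (θBal_pos)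
open Literature.MathematicalPhysics.QuantumFieldTheory.Balaban1983to89.T3ThresholdSmallness (exists_forall_θBal_le)
open Literature.MathematicalPhysics.QuantumFieldTheory.Balaban1983to89.T3Thresholds (exists_gamma_forall_θBal_le)
open Literature.MathematicalPhysics.QuantumFieldTheory.Balaban1983to89.T4Continuum
open scoped Literature.MathematicalPhysics.QuantumFieldTheory.Balaban1983to89.T3OrbitAverage
open Summit.QuantumFields.YangMills.Theorems.FluctuationComparisonRegPrIntLClosedGoodFibre (closure_fibre_inter_histGood_subset)
open Summit.QuantumFields.YangMills.Theorems.FluctuationComparisonRegPrIntLS2BetaChartContClosedProfile (closure_histGood_subset_profile)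
open Summit.QuantumFields.YangMills.Theorems.FluctuationComparisonRegPrIntLS2BetaWindowExactnessOfTower (minActionRegPr_le_action_of_histGood)
open Summit.QuantumFields.YangMills.Theorems.FluctuationComparisonRegPrIntLS2BetaArgminOrbitOfTower (regPr_of_argmin)
open Summit.QuantumFields.YangMills.Theorems.FluctuationComparisonRegPrIntLS2BetaSymmetriesLiftOfCritical (thm1Pair_five)
open Summit.QuantumFields.YangMills.Theorems.FluctuationComparisonRegPrIntLS2BetaGapFlatOrganOfRegArgminBar (gapFlatOrganAt_five_of_regArgminBarOrganAt)

/-! ## §1 The closed good fibre sits in the good fibre of the DOUBLED profile -/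

section Closure

/-- ★ **CLOSURE SLACK**: for every block size `L` and `b₀, p₀ > 0` there is `γ₁ ∈ (0, 1]` such that for every member `F` (`F.L = L`), every `0 < γ ≤ γ₁`, every `J ≤ K` and
every datum `V`: `closure (fibre V ∩ histGood θBal) ⊆ fibre V ∩ histGood (2·θBal)` — CL (✓`closure_fibre_inter_histGood_subset`) for the fibre; for the history, the closed
profile ✓`closure_histGood_subset_profile` (every intermediate plaquette variable `≤ θBal(K−i)`, by continuity of the averages on the small-field window) and `θBal < 2·θBal`
(✓`θBal_pos`).  Thresholds exactly as in ✓`exists_gamma_closedGoodFibre`: all `θBal ≤ δ₁/2`, `((3+2)L)²/4 · δ₁ ≤ δ_SU/2`. [cite: Balaban1985UV3, (7) p.257 and (41) p.266; Balaban1987RG1, (0.11) p.253] -/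
theorem exists_gamma_closure_goodFibre_subset_double (L : ℕ) {b₀ p₀ : ℝ} (hb : 0 < b₀) (hp : 0 < p₀) :
    ∃ γ₁ : ℝ, 0 < γ₁ ∧ γ₁ ≤ 1 ∧ ∀ (F : T3Family) (γ : ℝ), F.L = L → 0 < γ → γ ≤ γ₁ →
      ∀ (J K : ℕ) (hJK : J ≤ K) (V : GaugeField (F.P J) 0 (Matrix.specialUnitaryGroup (Fin 2) ℂ)),
        closure (fibre F ℰp J K hJK V ∩ histGood F ℰp (θBal F.L γ b₀ p₀) K J) ⊆
          fibre F ℰp J K hJK V ∩ histGood F ℰp (fun i => 2 * θBal F.L γ b₀ p₀ i) K J := by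
  -- adapted from ✓`FluctuationComparisonRegPrIntLClosedGoodFibre.exists_gamma_closedGoodFibre` (same `δ₁`, same `hsmall`)
  set δ₁ : ℝ := ExpMeanLog.deltaSU (Fin 2) / 2 / ((((3 + 2) * L : ℕ) : ℝ) ^ 2 / 4 + 1) with hδ₁def
  have hD : 0 < ((((3 + 2) * L : ℕ) : ℝ) ^ 2 / 4 + 1) := by positivity
  have hδ₁ : 0 < δ₁ := by
    rw [hδ₁def]; exact div_pos (half_pos ExpMeanLog.deltaSU_pos) hD
  obtain ⟨γ₁, hγ₁, hγ₁1, hθ⟩ := exists_gamma_forall_θBal_le (b₀ := b₀) (p₀ := p₀) hb hp (half_pos hδ₁)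
  refine ⟨γ₁, hγ₁, hγ₁1, fun F γ hFL hγ hγγ₁ J K hJK V => ?_⟩
  have hL : 1 ≤ F.L := F.hL.2.le
  subst hFL
  have hθ₁ : ∀ i, θBal F.L γ b₀ p₀ i < δ₁ := fun i => (hθ F.L hL γ hγ hγγ₁ i).trans_lt (half_lt_self hδ₁)
  have hsmall : (((((F.P K).d + 2) * (F.P K).L : ℕ) : ℝ) ^ 2 / 4) * δ₁ ≤ ExpMeanLog.deltaSU (Fin 2) / 2 := by
    have hd : (F.P K).d = 3 := T3Family.P_d F K
    have hLL : (F.P K).L = F.L := rfl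
    rw [hd, hLL, hδ₁def]
    rw [mul_div_assoc', div_le_iff₀ hD]
    have hq : 0 ≤ ExpMeanLog.deltaSU (Fin 2) / 2 := (half_pos ExpMeanLog.deltaSU_pos).le
    nlinarith [hq]
  intro U hU
  refine ⟨closure_fibre_inter_histGood_subset F hδ₁.le hθ₁ hsmall hJK V hU, ?_⟩
  -- the closed profile: every intermediate plaquette variable is `≤ θBal(K − i) < 2·θBal(K − i)`
  have hprof := closure_histGood_subset_profile F hJK hδ₁.le hθ₁ hsmall (closure_mono Set.inter_subset_right hU)
  rw [Summit.QuantumFields.YangMills.Theorems.PosOnSmallReduction.histGood_eq_setOf_forall_le F (fun i => 2 * θBal F.L γ b₀ p₀ i) hJK]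
  intro i hi p
  have hpos : 0 < θBal F.L γ b₀ p₀ (K - i) := θBal_pos hL hγ (hγγ₁.trans hγ₁1) hb p₀ (K - i)
  exact (hprof i hi p).trans_lt (by linarith)

end Closure

/-! ## §2 REG-ARGMIN̄(V) per datum from the Thm-1 pair letter at the doubled profile -/

section PerDatum

variable {F : T3Family}

/-- ★★★ **REG-ARGMIN̄(V) FROM THE THM-1 PAIR AT `L`, PER DATUM** — «every `U ∈ closure (fibre V ∩ histGood θBal)` with `A U ≤ minActionRegPr ε₀ V` is `RegPr ε₀`»
(px17 g14's `hRA` ∕ px8's `hreg` at infinite radius): given the closure slack of §1 at this datum and the DOUBLED profile `2·θBal` inside print's thresholds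
(`2θBal ≤ a₁`, `B₃·2θBal·L³ ≤ ε₀`, `4·2θBal·L³ < ε₀`, `ε₀ ≤ a₀`), such a `U` is a good history for `2·θBal` in the fibre, so `min ≤ A U` by px13 g21's tower
✓`minActionRegPr_le_action_of_histGood`, hence `A U = min`, and the equality chain ✓`regPr_of_argmin` makes it (6)-regular. [cite: Balaban1985Variational, Thm 1 (8)-(10) p.279, (2)-(8) p.278; Balaban1985UV3, (41)-(42) p.266] -/
theorem regArgminBarAt_of_thm1Pair_double {L : ℕ} {a₀ a₁ B₃ : ℝ} (hT : Thm1GlobalMinAt L a₀ a₁ B₃) (hU1 : Thm1UniqueMinOrbitAt L a₀ a₁ B₃)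
    (hB₃ : 0 < B₃) (hFL : F.L = L) {ε₀ γ b₀ p₀ : ℝ} (hε₀ : 0 < ε₀) (hε₀a : ε₀ ≤ a₀)
    (hθpos : ∀ i, 0 < θBal F.L γ b₀ p₀ i) (hθa : ∀ i, 2 * θBal F.L γ b₀ p₀ i ≤ a₁)
    (hθB : ∀ i, B₃ * (2 * θBal F.L γ b₀ p₀ i) * (F.L : ℝ) ^ 3 ≤ ε₀) (hθ4 : ∀ i, 4 * (2 * θBal F.L γ b₀ p₀ i) * (F.L : ℝ) ^ 3 < ε₀)
    {J K : ℕ} (hJK : J ≤ K) (V : GaugeField (F.P J) 0 (Matrix.specialUnitaryGroup (Fin 2) ℂ))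
    (hcl : closure (fibre F ℰp J K hJK V ∩ histGood F ℰp (θBal F.L γ b₀ p₀) K J) ⊆
      fibre F ℰp J K hJK V ∩ histGood F ℰp (fun i => 2 * θBal F.L γ b₀ p₀ i) K J) :
    ∀ U ∈ closure (fibre F ℰp J K hJK V ∩ histGood F ℰp (θBal F.L γ b₀ p₀) K J),
      wilsonAction4 U ≤ minActionRegPr F J K hJK ε₀ V → RegPr F J K ε₀ U := by
  intro U hUcl hle
  obtain ⟨hUf, hUg⟩ := hcl hUcl
  have hθpos2 : ∀ i, 0 < 2 * θBal F.L γ b₀ p₀ i := fun i => by linarith [hθpos i]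
  have hlow : minActionRegPr F J K hJK ε₀ V ≤ wilsonAction4 U :=
    minActionRegPr_le_action_of_histGood (F := F) hT hB₃ hFL hε₀a (θ := fun i => 2 * θBal F.L γ b₀ p₀ i) hθpos2 hθa hθB hθ4 hJK hUf hUg
  have hA : wilsonAction4 U = minActionRegPr F J K hJK ε₀ V := le_antisymm hle hlow
  exact ((mem_regFibrePr_iff F).mp
    (regPr_of_argmin (F := F) hT hU1 hB₃ hFL hε₀ hε₀a (θ := fun i => 2 * θBal F.L γ b₀ p₀ i) hθpos2 hθa hθB hθ4 hJK hUf hUg hA)).2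

end PerDatum

/-! ## §3 ★★★★ REG-ARGMIN̄∘ at `L` OUTRIGHT, every `L ≥ 5` -/

section Organ

/-- ★★★★ **REG-ARGMIN̄∘-at-`L` FROM THE THM-1 PAIR AT `L`** (every `L > 1`; organ prefix with `c₀ := 1`, `pS := 0`, `ε₁ := a₀`, `γ₁ := min` of the closure-slack coupling of §1
and the threshold coupling `θBal ≤ min a₁∕2 (ε₀ ∕ (4(4+B₃)L³))` of ✓`exists_forall_θBal_le` — ✓`argminRegularOrbit_at`'s arithmetic with the constant doubled; the window
guard on `V` is not even used). [cite: Balaban1985Variational, Thm 1 (8)-(10) p.279 and Prop. 7 p.299; Balaban1985UV3, (41)-(42) p.266] -/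
theorem regArgminBarOrganAt_of_thm1Pair {L : ℕ} (hL1 : 1 < L) {a₀ a₁ B₃ : ℝ} (ha₀ : 0 < a₀) (ha₁ : 0 < a₁) (hB₃ : 0 < B₃)
    (hT : Thm1GlobalMinAt L a₀ a₁ B₃) (hU1 : Thm1UniqueMinOrbitAt L a₀ a₁ B₃) :
    ∃ c₀ : ℝ, 0 < c₀ ∧ c₀ ≤ 1 ∧ ∀ (cw : ℝ), 0 < cw → cw ≤ c₀ → ∃ pS : ℝ, ∀ (b₀ p₀ : ℝ), 0 < b₀ → pS ≤ p₀ → 0 < p₀ →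
      ∃ ε₁ : ℝ, 0 < ε₁ ∧ ∀ (ε₀ : ℝ), 0 < ε₀ → ε₀ ≤ ε₁ →
      ∃ γ₁ : ℝ, 0 < γ₁ ∧ ∀ (F : T3Family) (γ : ℝ), F.L = L → 0 < γ → γ ≤ γ₁ →
        ∀ (J K : ℕ) (hJK : J ≤ K) (V : GaugeField (F.P J) 0 (Matrix.specialUnitaryGroup (Fin 2) ℂ)), PlaqSmall (θBal F.L γ (cw * b₀) p₀ J) V →
          ∀ U ∈ closure (fibre F ℰp J K hJK V ∩ histGood F ℰp (θBal F.L γ b₀ p₀) K J),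
            wilsonAction4 U ≤ minActionRegPr F J K hJK ε₀ V → RegPr F J K ε₀ U := by
  -- adapted from ✓px13 g21 `…S2BetaArgminOrbitOfTower.argminRegularOrbit_at` (constant `c` doubled; closure slack of §1 merged into `γ₁`)
  have hL : 1 ≤ L := hL1.le
  have hL0 : (0 : ℝ) < (L : ℝ) := by exact_mod_cast (show 0 < L by omega)
  refine ⟨1, one_pos, le_rfl, fun cw hcw0 hcw1 => ⟨0, fun b₀ p₀ hb _ hp => ⟨a₀, ha₀, fun ε₀ hε₀ hε₀a => ?_⟩⟩⟩
  set c : ℝ := 4 * (4 + B₃) * (L : ℝ) ^ 3 with hc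
  have hcpos : 0 < c := by positivity
  obtain ⟨γθ, hγθ, Hθ⟩ := exists_forall_θBal_le hL b₀ p₀ (lt_min (half_pos ha₁) (div_pos hε₀ hcpos))
  obtain ⟨γc, hγc, hγc1, Hcl⟩ := exists_gamma_closure_goodFibre_subset_double L (b₀ := b₀) (p₀ := p₀) hb hp
  refine ⟨min γθ γc, lt_min hγθ hγc, fun F γ hFL hγ hγle J K hJK V _ => ?_⟩
  have hγθ' : γ ≤ γθ := hγle.trans (min_le_left _ _)
  have hγc' : γ ≤ γc := hγle.trans (min_le_right _ _)
  have hγ1 : γ ≤ 1 := hγc'.trans hγc1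
  have hθle : ∀ i, θBal F.L γ b₀ p₀ i ≤ min (a₁ / 2) (ε₀ / c) := fun i => by rw [hFL]; exact Hθ γ hγ hγθ' i
  have hθpos : ∀ i, 0 < θBal F.L γ b₀ p₀ i := fun i => θBal_pos F.hL.2.le hγ hγ1 hb p₀ i
  have hθa : ∀ i, 2 * θBal F.L γ b₀ p₀ i ≤ a₁ := fun i => by linarith [(hθle i).trans (min_le_left _ _)]
  have hθc : ∀ i, θBal F.L γ b₀ p₀ i * c ≤ ε₀ := fun i => by
    have h := (hθle i).trans (min_le_right _ _)
    rwa [le_div_iff₀ hcpos] at h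
  have hFL3 : (F.L : ℝ) ^ 3 = (L : ℝ) ^ 3 := by rw [hFL]
  have hθB : ∀ i, B₃ * (2 * θBal F.L γ b₀ p₀ i) * (F.L : ℝ) ^ 3 ≤ ε₀ := fun i => by
    have h1 : 2 * B₃ * (F.L : ℝ) ^ 3 ≤ c := by rw [hFL3, hc]; nlinarith [pow_pos hL0 3]
    calc B₃ * (2 * θBal F.L γ b₀ p₀ i) * (F.L : ℝ) ^ 3 = θBal F.L γ b₀ p₀ i * (2 * B₃ * (F.L : ℝ) ^ 3) := by ring
      _ ≤ θBal F.L γ b₀ p₀ i * c := mul_le_mul_of_nonneg_left h1 (hθpos i).le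
      _ ≤ ε₀ := hθc i
  have hθ4 : ∀ i, 4 * (2 * θBal F.L γ b₀ p₀ i) * (F.L : ℝ) ^ 3 < ε₀ := fun i => by
    have h1 : 8 * (F.L : ℝ) ^ 3 < c := by rw [hFL3, hc]; nlinarith [pow_pos hL0 3]
    calc 4 * (2 * θBal F.L γ b₀ p₀ i) * (F.L : ℝ) ^ 3 = θBal F.L γ b₀ p₀ i * (8 * (F.L : ℝ) ^ 3) := by ring
      _ < θBal F.L γ b₀ p₀ i * c := mul_lt_mul_of_pos_left h1 (hθpos i)
      _ ≤ ε₀ := hθc i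
  exact regArgminBarAt_of_thm1Pair_double hT hU1 hB₃ hFL hε₀ hε₀a hθpos hθa hθB hθ4 hJK V (Hcl F γ hFL hγ hγc' J K hJK V)

/-- ★★★★ **REG-ARGMIN̄∘-at-`L` OUTRIGHT, ZERO HYPOTHESES, AT EVERY BLOCK SIZE `L ≥ 5`** (the Thm-1 pair at `L` is ✓`thm1Pair_five`). [cite: Balaban1985Variational, Thm 1 (8)-(10) p.279 and Prop. 7 p.299] -/
theorem regArgminBarOrganAt_five (L : ℕ) (h5 : 5 ≤ L) :
    ∃ c₀ : ℝ, 0 < c₀ ∧ c₀ ≤ 1 ∧ ∀ (cw : ℝ), 0 < cw → cw ≤ c₀ → ∃ pS : ℝ, ∀ (b₀ p₀ : ℝ), 0 < b₀ → pS ≤ p₀ → 0 < p₀ →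
      ∃ ε₁ : ℝ, 0 < ε₁ ∧ ∀ (ε₀ : ℝ), 0 < ε₀ → ε₀ ≤ ε₁ →
      ∃ γ₁ : ℝ, 0 < γ₁ ∧ ∀ (F : T3Family) (γ : ℝ), F.L = L → 0 < γ → γ ≤ γ₁ →
        ∀ (J K : ℕ) (hJK : J ≤ K) (V : GaugeField (F.P J) 0 (Matrix.specialUnitaryGroup (Fin 2) ℂ)), PlaqSmall (θBal F.L γ (cw * b₀) p₀ J) V →
          ∀ U ∈ closure (fibre F ℰp J K hJK V ∩ histGood F ℰp (θBal F.L γ b₀ p₀) K J),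
            wilsonAction4 U ≤ minActionRegPr F J K hJK ε₀ V → RegPr F J K ε₀ U := by
  obtain ⟨a₀, a₁, B₃, ha₀, ha₁, hB₃, hT, hU1⟩ := thm1Pair_five L h5
  exact regArgminBarOrganAt_of_thm1Pair (by omega) ha₀ ha₁ hB₃ hT hU1

end Organ

/-! ## §4 ★★★★★ GAP♭∘ at `L` OUTRIGHT, every `L ≥ 5` -/

section Gap

/-- ★★★★★ **THE v12-CANDIDATE ORGAN GAP♭∘ READ AT `L` IS A THEOREM AT EVERY BLOCK SIZE `L ≥ 5` — ZERO HYPOTHESES.**  Text = px17 g14's CERT 603780ac edition of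
`UniformFibreGapOrbit` (`∃ μ` AFTER the base point `U₀ ∈ argminHist V`; the coupling threshold `γ₁` UNIFORM, before `F, γ, J, K, V`), δ-unfolded as ✓`orb_of_gapFlat`'s `hG`
at one `L`: for every interior-window datum `V`, every action-minimising good history `U₀` over it, SOME `μ > 0` with
`μ·L^{−2(K−J)}·⨅_{w residual} Σ_ℓ dist1(U ℓ·((w • U₀) ℓ)⁻¹)² ≤ A(U) − minActionRegPr ε₀ V` for every good history `U` of the fibre.
:= ✓`gapFlatOrganAt_five_of_regArgminBarOrganAt L h5 (regArgminBarOrganAt_five L h5)`. [cite: Balaban1985Variational, Thm 1 (8)-(10) p.279, Prop. 7 and (142) p.299; Balaban1985UV3, (18)-(22) p.260] -/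
theorem gapFlatOrganAt_five (L : ℕ) (h5 : 5 ≤ L) :
    ∃ c₀ : ℝ, 0 < c₀ ∧ c₀ ≤ 1 ∧ ∀ (cw : ℝ), 0 < cw → cw ≤ c₀ → ∃ pS : ℝ, ∀ (b₀ p₀ : ℝ), 0 < b₀ → pS ≤ p₀ → 0 < p₀ →
      ∃ ε₁ : ℝ, 0 < ε₁ ∧ ∀ (ε₀ : ℝ), 0 < ε₀ → ε₀ ≤ ε₁ →
      ∃ γ₁ : ℝ, 0 < γ₁ ∧ ∀ (F : T3Family) (γ : ℝ), F.L = L → 0 < γ → γ ≤ γ₁ →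
        ∀ (J K : ℕ) (hJK : J ≤ K) (V : GaugeField (F.P J) 0 (Matrix.specialUnitaryGroup (Fin 2) ℂ)), PlaqSmall (θBal F.L γ (cw * b₀) p₀ J) V →
          ∀ U₀ ∈ {U' | U' ∈ fibre F ℰp J K hJK V ∧ U' ∈ histGood F ℰp (θBal F.L γ b₀ p₀) K J ∧
              wilsonAction4 U' = minActionRegPr F J K hJK ε₀ V}, ∃ μ : ℝ, 0 < μ ∧
            ∀ U ∈ fibre F ℰp J K hJK V, U ∈ histGood F ℰp (θBal F.L γ b₀ p₀) K J →
              μ * ((F.L : ℝ)⁻¹) ^ (2 * (K - J)) *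
                  (⨅ w : {w : Site (F.P K) 0 → Matrix.specialUnitaryGroup (Fin 2) ℂ |
                      ∀ U : GaugeField (F.P K) 0 (Matrix.specialUnitaryGroup (Fin 2) ℂ),
                        descendTo F ℰp J K hJK (GaugeField.gaugeAct w U) = descendTo F ℰp J K hJK U},
                    ∑ ℓ : PBond (F.P K) 0,
                      dist1 (U ℓ * ((GaugeField.gaugeAct (w : Site (F.P K) 0 → Matrix.specialUnitaryGroup (Fin 2) ℂ) U₀) ℓ)⁻¹) ^ 2)
                ≤ wilsonAction4 U - minActionRegPr F J K hJK ε₀ V :=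
  gapFlatOrganAt_five_of_regArgminBarOrganAt L h5 (regArgminBarOrganAt_five L h5)

end Gap

end Summit.QuantumFields.YangMills.Theorems.FluctuationComparisonRegPrIntLS2BetaGapFlatOrganFive

end
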